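import Mathlib
import HarnessLib
import Summits.ResolutionOfSingularities.ResolutionOfSingularities.Theorems.WildQuotientsWildQuotientResolutionConductorOneDefs

/-!
# S2: the quotient map `Spec (CoreRing k p n) → Spec (CoreRing k p n)^⟨σ⟩` (one abbreviation)
(crux stmt-ResolutionOfSingularities-15640 `WildQuotients.WildQuotientResolution`, line `Sketch`; chain w45c
post-V5 programme S2; scaffold SIG `L/res-L1-w45c-lead-1/stubs/ConductorOneF8Sig.lean`. [OURS · L1 W4.5c] —
NOT a statement of the manuscript. Lead prover res-L1-w45c-lead-1.)

`ConductorOne.coreQuotMap k p n σ := Spec (algebraMap (FixedPoints.subalgebra k (CoreRing k p n) ⟨σ⟩) (CoreRing k p n))`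
— the base morphism of G2 for `B = CoreRing k p n`, `G = ⟨σ⟩`. It is an `abbrev` so that G2
(`AffineQuotient.hasResolution_spec_fixedPoints_of_model`) applies literally; it exists because spelling the
`Spec.map` out inside the frame brick HF makes the binder elaboration time out (lead-1 g5, F8 SIG v1).
-/

-- single-problem summit: the doubled namespace component `ResolutionOfSingularities` is forced
set_option linter.dupNamespace false

noncomputable section

open CategoryTheory AlgebraicGeometry

namespace Summit.ResolutionOfSingularities.ResolutionOfSingularities.Theorems.WildQuotientResolution.ConductorOne

/-- The quotient map `Spec (CoreRing k p n) ⟶ Spec (CoreRing k p n)^⟨σ⟩`. [OURS · L1 W4.5c] -/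
abbrev coreQuotMap (k : Type) [Field k] (p n : ℕ) (σ : CoreRing k p n ≃ₐ[k] CoreRing k p n) :
    Spec (CommRingCat.of (CoreRing k p n)) ⟶
      Spec (CommRingCat.of (FixedPoints.subalgebra k (CoreRing k p n) ↥(Subgroup.zpowers σ))) :=
  Spec.map (CommRingCat.ofHom (algebraMap
    (FixedPoints.subalgebra k (CoreRing k p n) ↥(Subgroup.zpowers σ)) (CoreRing k p n)))

end Summit.ResolutionOfSingularities.ResolutionOfSingularities.Theorems.WildQuotientResolution.ConductorOne

end
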